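import Summits.QuantumFields.YangMills.Theorems.PoincareLipschitzDyadicMeansWeakLimitCube
import Literature.Analysis.FunctionSpaces.SobolevDomain
import HarnessLib

/-!
# (Γ2-W) The weak `L²` limit from dyadic means — the (Γ2-IBP) socket rows

Brick (Γ2-W) FILE 3 of LINE 25 «CompactnessTransfer» (crux `PoincareLipschitz.BlockLipschitzL`,
stmt-QuantumFields-23533; crux of record `UnitScaleTilt.HistoryTailL`, stmt-QuantumFields-19936;
LEAD ★w1-19936 g9 12:02:03Z GO, successor LEAD ★w1-19936 g10 2026-08-29 12:29:32Z S2♭″ ARCHITECTURE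
v0 «please ALSO export the pairing row for `IsTestFunctionOn ⟨Q,hQ⟩ φ` and, if cheap, the SUB-CUBE lsc
row»).

`exists_weakLimit_of_dyadicMeans_socket` = ✓`PoincareLipschitzDyadicMeansWeakLimitCube.exists_weakLimit_of_dyadicMeans`
with the three rows the (Γ2-IBP) pen consumes: `IntegrableOn G Q volume`; the vector pairing
`∫_Q φ • v k → ∫_Q φ • G` for every `φ` with `IsTestFunctionOn ⟨Q, hQ⟩ φ` (lit `SobolevDomain`
vocabulary: smooth, compactly supported in `Q` ⇒ bounded and a.e.-strongly measurable); and the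
SUB-CUBE LOWER SEMICONTINUITY row in eventual-bound form — for `0 < t ≤ 1` and any `M`, if
eventually `∫_{Q_t} ‖v k‖² ≤ M` then `∫_{Q_t} ‖G‖² ≤ M` (`Q_t = {|xᵢ| < t}`; proof: the `ℒ²` pairing
clause with `ψ := 𝟙_{Q_t} • G` and Cauchy–Schwarz in `L²(Q_t)`, `sub_cube_sq_integral_le_of_eventually`).

HONEST: a helper (`--supports stmt-QuantumFields-19936 --as helper`); nothing of Γ2, S2♭″,
`BlockLipschitzL`, `HistoryTailL` is proved here; rung R3 = YM₃ on T³ — not d = 4, not Clay.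
-/

set_option autoImplicit false

open MeasureTheory Filter Topology Set
open scoped RealInnerProductSpace ENNReal BigOperators

namespace Summit.QuantumFields.YangMills.Theorems.PoincareLipschitzDyadicMeansWeakLimitSocket

open Summit.QuantumFields.YangMills.Theorems.PoincareLipschitzSamplingCells (isOpen_absCube)
open Summit.QuantumFields.YangMills.Theorems.PoincareLipschitzDyadicMeansWeakLimit
open Summit.QuantumFields.YangMills.Theorems.PoincareLipschitzDyadicMeansWeakLimitCube
open Literature.Analysis.FunctionSpaces (IsTestFunctionOn)

/-! ## §1 Cauchy–Schwarz on a sub-cube and the lower-semicontinuity row -/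

/-- The sub-cube `Q_t` lies in `Q` for `t ≤ 1`. [folklore] -/
theorem absCube_mono {t : ℝ} (ht : t ≤ 1) :
    {x : EuclideanSpace ℝ (Fin 3) | ∀ i : Fin 3, |x i| < t} ⊆
      {x : EuclideanSpace ℝ (Fin 3) | ∀ i : Fin 3, |x i| < 1} :=
  fun _ hx i => lt_of_lt_of_le (hx i) ht

/-- Restricting `volume.restrict Q` to the sub-cube `Q_t ⊆ Q` is `volume.restrict Q_t`. [folklore] -/
theorem restrict_openCube_restrict_absCube {t : ℝ} (ht : t ≤ 1) :
    (volume.restrict {x : EuclideanSpace ℝ (Fin 3) | ∀ i : Fin 3, |x i| < 1}).restrict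
        {x : EuclideanSpace ℝ (Fin 3) | ∀ i : Fin 3, |x i| < t} =
      volume.restrict {x : EuclideanSpace ℝ (Fin 3) | ∀ i : Fin 3, |x i| < t} := by
  rw [Measure.restrict_restrict (isOpen_absCube t).measurableSet,
    inter_eq_self_of_subset_left (absCube_mono ht)]

/-- **Cauchy–Schwarz for the `ℒ²` pairing on a set**: `∫_S ⟪G, w⟫ ≤ √(∫_S ‖G‖²) · √(∫_S ‖w‖²)`
(through `L²(μ.restrict S)` and `real_inner_le_norm`). [folklore] -/
theorem setIntegral_inner_le_sqrt_mul_sqrt {X : Type*} [MeasurableSpace X] {μ : Measure X}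
    {F : Type*} [NormedAddCommGroup F] [InnerProductSpace ℝ F]
    {S : Set X} {G w : X → F} (hG : MemLp G 2 (μ.restrict S)) (hw : MemLp w 2 (μ.restrict S)) :
    ∫ x in S, ⟪G x, w x⟫ ∂μ ≤
      Real.sqrt (∫ x in S, ‖G x‖ ^ 2 ∂μ) * Real.sqrt (∫ x in S, ‖w x‖ ^ 2 ∂μ) := by
  have h1 : ∫ x in S, ⟪G x, w x⟫ ∂μ = ⟪hG.toLp G, hw.toLp w⟫ := (inner_toLp_toLp hG hw).symm
  have h2 : Real.sqrt (∫ x in S, ‖G x‖ ^ 2 ∂μ) = ‖hG.toLp G‖ := by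
    rw [← norm_toLp_two_sq hG, Real.sqrt_sq (norm_nonneg _)]
  have h3 : Real.sqrt (∫ x in S, ‖w x‖ ^ 2 ∂μ) = ‖hw.toLp w‖ := by
    rw [← norm_toLp_two_sq hw, Real.sqrt_sq (norm_nonneg _)]
  rw [h1, h2, h3]
  exact real_inner_le_norm _ _

/-- **Lower semicontinuity on a set, eventual-bound form.**  If `∫_S ⟪G, v k⟫ → ∫_S ‖G‖²`
(weak convergence tested against `G` itself on `S`) and eventually `∫_S ‖v k‖² ≤ M`, then
`∫_S ‖G‖² ≤ M`. [folklore] -/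
theorem setIntegral_sq_le_of_tendsto_inner {X : Type*} [MeasurableSpace X] {μ : Measure X}
    {F : Type*} [NormedAddCommGroup F] [InnerProductSpace ℝ F]
    {S : Set X} {G : X → F} {v : ℕ → X → F} (hG : MemLp G 2 (μ.restrict S))
    (hv : ∀ k, MemLp (v k) 2 (μ.restrict S))
    (hlim : Tendsto (fun k => ∫ x in S, ⟪G x, v k x⟫ ∂μ) atTop (𝓝 (∫ x in S, ‖G x‖ ^ 2 ∂μ)))
    {M : ℝ} (hM : ∀ᶠ k in atTop, ∫ x in S, ‖v k x‖ ^ 2 ∂μ ≤ M) :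
    ∫ x in S, ‖G x‖ ^ 2 ∂μ ≤ M := by
  obtain ⟨k₀, hk₀⟩ := hM.exists
  have hM0 : 0 ≤ M := le_trans (integral_nonneg fun x => sq_nonneg _) hk₀
  have hg0 : 0 ≤ ∫ x in S, ‖G x‖ ^ 2 ∂μ := integral_nonneg fun x => sq_nonneg _
  -- pass the Cauchy–Schwarz bound to the limit
  have hle : ∫ x in S, ‖G x‖ ^ 2 ∂μ ≤ Real.sqrt (∫ x in S, ‖G x‖ ^ 2 ∂μ) * Real.sqrt M := by
    refine le_of_tendsto hlim ?_
    filter_upwards [hM] with k hk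
    calc ∫ x in S, ⟪G x, v k x⟫ ∂μ
        ≤ Real.sqrt (∫ x in S, ‖G x‖ ^ 2 ∂μ) * Real.sqrt (∫ x in S, ‖v k x‖ ^ 2 ∂μ) :=
          setIntegral_inner_le_sqrt_mul_sqrt hG (hv k)
      _ ≤ Real.sqrt (∫ x in S, ‖G x‖ ^ 2 ∂μ) * Real.sqrt M :=
          mul_le_mul_of_nonneg_left (Real.sqrt_le_sqrt hk) (Real.sqrt_nonneg _)
  -- `g² ≤ g √M` with `g = √(g²)` gives `g ≤ √M`, i.e. `g² ≤ M`
  set g := Real.sqrt (∫ x in S, ‖G x‖ ^ 2 ∂μ) with hg_def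
  have hgsq : g ^ 2 = ∫ x in S, ‖G x‖ ^ 2 ∂μ := Real.sq_sqrt hg0
  rcases (Real.sqrt_nonneg (∫ x in S, ‖G x‖ ^ 2 ∂μ)).eq_or_lt with h0 | hpos
  · -- `g = 0`
    have hg0' : g = 0 := by rw [hg_def]; exact h0.symm
    rw [← hgsq, hg0']
    simpa using hM0
  · have h1 : g * g ≤ g * Real.sqrt M := by rw [← sq, hgsq]; exact hle
    have h2 : g ≤ Real.sqrt M := le_of_mul_le_mul_left h1 hpos
    calc ∫ x in S, ‖G x‖ ^ 2 ∂μ = g ^ 2 := hgsq.symm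
      _ ≤ (Real.sqrt M) ^ 2 := pow_le_pow_left₀ hpos.le h2 2
      _ = M := Real.sq_sqrt hM0

/-! ## §2 The socket theorem -/

/-- **(Γ2-W) socket form.**  For `v k ∈ ℒ²(Q; ℝ⁴)` with `∫_Q ‖v k‖² ≤ Λ` whose dyadic-cell means
all converge (Γ1 `(c4)`, per direction), there is ONE `G` with: `MemLp G 2 (volume.restrict Q)`,
`IntegrableOn G Q`, `∫_Q ‖G‖² ≤ Λ`; cell means `∫_{D_{m,j}} v k → ∫_{D_{m,j}} G`; the test-function
pairing `∫_Q φ • v k → ∫_Q φ • G` for every `φ` with `IsTestFunctionOn ⟨Q, hQ⟩ φ`; and sub-cube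
lower semicontinuity in eventual-bound form: for `0 < t ≤ 1`, if eventually `∫_{Q_t} ‖v k‖² ≤ M`
then `∫_{Q_t} ‖G‖² ≤ M`.  Whole sequence, no further subsequence.
[folklore: Riesz + density of dyadic step functions + Cauchy–Schwarz] -/
theorem exists_weakLimit_of_dyadicMeans_socket
    (v : ℕ → EuclideanSpace ℝ (Fin 3) → EuclideanSpace ℝ (Fin 4))
    (hv : ∀ k, MemLp (v k) 2 (volume.restrict {x : EuclideanSpace ℝ (Fin 3) | ∀ i : Fin 3, |x i| < 1}))
    (Λ : ℝ) (hΛ : ∀ k, ∫ x in {x : EuclideanSpace ℝ (Fin 3) | ∀ i : Fin 3, |x i| < 1}, ‖v k x‖ ^ 2 ≤ Λ)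
    (hc4 : ∀ (m : ℕ) (j : Fin 3 → Fin (2 ^ m)), ∃ g : EuclideanSpace ℝ (Fin 4),
      Tendsto (fun k : ℕ => ∫ x in {x : EuclideanSpace ℝ (Fin 3) | ∀ i : Fin 3,
        (-1 : ℝ) + 2 * (j i : ℕ) / (2 : ℝ) ^ m ≤ x i ∧ x i < (-1 : ℝ) + 2 * ((j i : ℕ) + 1) / (2 : ℝ) ^ m}, v k x)
        atTop (𝓝 g)) :
    ∃ G : EuclideanSpace ℝ (Fin 3) → EuclideanSpace ℝ (Fin 4),
      MemLp G 2 (volume.restrict {x : EuclideanSpace ℝ (Fin 3) | ∀ i : Fin 3, |x i| < 1}) ∧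
      IntegrableOn G {x : EuclideanSpace ℝ (Fin 3) | ∀ i : Fin 3, |x i| < 1} volume ∧
      ∫ x in {x : EuclideanSpace ℝ (Fin 3) | ∀ i : Fin 3, |x i| < 1}, ‖G x‖ ^ 2 ≤ Λ ∧
      (∀ (m : ℕ) (j : Fin 3 → Fin (2 ^ m)),
        Tendsto (fun k : ℕ => ∫ x in {x : EuclideanSpace ℝ (Fin 3) | ∀ i : Fin 3,
          (-1 : ℝ) + 2 * (j i : ℕ) / (2 : ℝ) ^ m ≤ x i ∧ x i < (-1 : ℝ) + 2 * ((j i : ℕ) + 1) / (2 : ℝ) ^ m}, v k x)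
          atTop (𝓝 (∫ x in {x : EuclideanSpace ℝ (Fin 3) | ∀ i : Fin 3,
          (-1 : ℝ) + 2 * (j i : ℕ) / (2 : ℝ) ^ m ≤ x i ∧ x i < (-1 : ℝ) + 2 * ((j i : ℕ) + 1) / (2 : ℝ) ^ m}, G x))) ∧
      (∀ (hQ : IsOpen {x : EuclideanSpace ℝ (Fin 3) | ∀ i : Fin 3, |x i| < 1})
        (φ : EuclideanSpace ℝ (Fin 3) → ℝ),
        IsTestFunctionOn ⟨{x : EuclideanSpace ℝ (Fin 3) | ∀ i : Fin 3, |x i| < 1}, hQ⟩ φ →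
        Tendsto (fun k : ℕ => ∫ x in {x : EuclideanSpace ℝ (Fin 3) | ∀ i : Fin 3, |x i| < 1}, φ x • v k x)
          atTop (𝓝 (∫ x in {x : EuclideanSpace ℝ (Fin 3) | ∀ i : Fin 3, |x i| < 1}, φ x • G x))) ∧
      (∀ (t : ℝ), 0 < t → t ≤ 1 → ∀ M : ℝ,
        (∀ᶠ k in atTop, ∫ x in {x : EuclideanSpace ℝ (Fin 3) | ∀ i : Fin 3, |x i| < t}, ‖v k x‖ ^ 2 ≤ M) →
        ∫ x in {x : EuclideanSpace ℝ (Fin 3) | ∀ i : Fin 3, |x i| < t}, ‖G x‖ ^ 2 ≤ M) := by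
  haveI : IsFiniteMeasure (volume.restrict {x : EuclideanSpace ℝ (Fin 3) | ∀ i : Fin 3, |x i| < 1}) :=
    isFiniteMeasure_restrict.2 volume_openCube_lt_top.ne
  obtain ⟨G, hG, hGΛ, hGmean, hGψ, hGφ⟩ := exists_weakLimit_of_dyadicMeans v hv Λ hΛ hc4
  refine ⟨G, hG, hG.integrable one_le_two, hGΛ, hGmean, fun hQ φ hφ => ?_, fun t ht ht1 M hM => ?_⟩
  · -- test functions are bounded and a.e.-strongly measurable
    have hcont : Continuous φ := hφ.contDiff.continuous
    obtain ⟨B, hB⟩ := hcont.bounded_above_of_compact_support hφ.hasCompactSupport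
    exact hGφ φ B hcont.aestronglyMeasurable (fun x => by
      have := hB x; rwa [Real.norm_eq_abs] at this)
  · -- sub-cube lower semicontinuity via `ψ := 𝟙_{Q_t} • G`
    have hSt : MeasurableSet {x : EuclideanSpace ℝ (Fin 3) | ∀ i : Fin 3, |x i| < t} :=
      (isOpen_absCube t).measurableSet
    have hψ : MemLp ({x : EuclideanSpace ℝ (Fin 3) | ∀ i : Fin 3, |x i| < t}.indicator G) 2
        (volume.restrict {x : EuclideanSpace ℝ (Fin 3) | ∀ i : Fin 3, |x i| < 1}) := hG.indicator hSt
    have hlim := hGψ _ hψ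
    -- rewrite the pairings as integrals over `Q_t`
    have hrew : ∀ w : EuclideanSpace ℝ (Fin 3) → EuclideanSpace ℝ (Fin 4),
        ∫ x in {x : EuclideanSpace ℝ (Fin 3) | ∀ i : Fin 3, |x i| < 1},
          ⟪{x : EuclideanSpace ℝ (Fin 3) | ∀ i : Fin 3, |x i| < t}.indicator G x, w x⟫ =
        ∫ x in {x : EuclideanSpace ℝ (Fin 3) | ∀ i : Fin 3, |x i| < t}, ⟪G x, w x⟫ := by
      intro w
      have hpt : (fun x => ⟪{x : EuclideanSpace ℝ (Fin 3) | ∀ i : Fin 3, |x i| < t}.indicator G x, w x⟫) =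
          {x : EuclideanSpace ℝ (Fin 3) | ∀ i : Fin 3, |x i| < t}.indicator (fun x => ⟪G x, w x⟫) := by
        funext x
        by_cases hx : x ∈ {x : EuclideanSpace ℝ (Fin 3) | ∀ i : Fin 3, |x i| < t}
        · rw [indicator_of_mem hx, indicator_of_mem hx]
        · rw [indicator_of_notMem hx, indicator_of_notMem hx, inner_zero_left]
      rw [hpt, integral_indicator hSt, restrict_openCube_restrict_absCube ht1]
    simp_rw [hrew] at hlim
    have hGG : ∫ x in {x : EuclideanSpace ℝ (Fin 3) | ∀ i : Fin 3, |x i| < t}, ⟪G x, G x⟫ =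
        ∫ x in {x : EuclideanSpace ℝ (Fin 3) | ∀ i : Fin 3, |x i| < t}, ‖G x‖ ^ 2 := by
      refine integral_congr_ae (Eventually.of_forall fun x => ?_)
      exact real_inner_self_eq_norm_sq (G x)
    rw [hGG] at hlim
    -- `ℒ²` memberships on `Q_t`
    have hGt : MemLp G 2 (volume.restrict {x : EuclideanSpace ℝ (Fin 3) | ∀ i : Fin 3, |x i| < t}) := by
      rw [← restrict_openCube_restrict_absCube ht1]; exact hG.restrict _
    have hvt : ∀ k, MemLp (v k) 2 (volume.restrict {x : EuclideanSpace ℝ (Fin 3) | ∀ i : Fin 3, |x i| < t}) :=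
      fun k => by rw [← restrict_openCube_restrict_absCube ht1]; exact (hv k).restrict _
    exact setIntegral_sq_le_of_tendsto_inner (μ := volume) hGt hvt hlim hM

end Summit.QuantumFields.YangMills.Theorems.PoincareLipschitzDyadicMeansWeakLimitSocket
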